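/-
Copyright (c) 2026 the pub-hodgecm-mathlib formalisation cell (harness21).  Prover seat hodgecm-mathlib-F0P3-p01 (g30), «(D-RAM) FOUR-FRAME» road of crux H413, line LH4, unit U3
(dealer LH4-plan (g10) WORDs #38 (2) ∕ #39 (1) ∕ #42 (3), LEAD ruling (R-17) «(S)-HEADS RE-LINE: NI2 ⊕ MS»): the PAYER of (NI2) `stub_U3_normIndexTwo` — LOCAL NORM INDEX TWO
AT A RAMIFIED QUADRATIC DATUM, with a unit witness — over LH4-p09 (g2)'s ★ unit dichotomy (LEG 1 ★ p855352 graded steps, LEG 2 ★ `WildQuadraticDatumUnitNormIndexTwo`).  2026-09-03.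
-/
import Literature.NumberTheory.LocalFields.WildQuadraticDatumUnitNormIndexTwo   -- ★ LEG 2 (LH4-p09 (g2)): `exists_unit_norm_dichotomy_of_isRamifiedQuadraticDatum` (the dichotomy on the σ-FIXED UNITS, tame + wild); brings ★ LEG 1 p855352 `WildQuadraticDatumNormGradedSteps` (`mul_map_mul_map`), ★ `WildQuadraticDatumTrace`, ★ `IsRamifiedQuadraticDatum`
import Literature.NumberTheory.LocalFields.WildQuadraticDatumRefSkewScalar     -- ★ `map_varpi_mul_map` (`σ(ϖσϖ) = ϖσϖ`)
import Literature.NumberTheory.LocalFields.ValuedCompleteIsAdicComplete         -- ★ `isAdicComplete_valuedInteger_of_completeSpace` (`[CompleteSpace K]` ⇒ `IsAdicComplete 𝓂[K] 𝒪[K]`)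
import HarnessLib

/-!
# F0 · P3c · line LH4 «(D-RAM) FOUR-FRAME» — unit U3 §S-R: (NI2) LOCAL NORM INDEX TWO AT A RAMIFIED QUADRATIC DATUM, the payer `normIndexTwo`
# (Serre, *Local Fields*, Ch. V §3 Prop. 5, Cor. 2–3; Ch. XV §2; Neukirch, *ANT*, Ch. V (1.3))

Cell `pub/hodgecm-mathlib`, crux H413 = `stmt-HodgeConjecture-24833` (helper lane `--supports stmt-HodgeConjecture-24833 --as helper`), route HCCMUnconditional; THEOREMS ONLY
(no definition, no instance, no notation, no named fact, no `sorry`, no `set_option` beyond `autoImplicit false`; default heartbeats).  Conclusion = the registered tier-1 stub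
`Summit.….Cruxes.H413.F0P3cDyRamFourFrameU3.U3_Laws.stub_U3_normIndexTwo` (U3 ED. 4) TOKEN FOR TOKEN (`{K : Type}`, `[CompleteSpace K] [Fintype 𝓀[K]]`): for every
`IsRamifiedQuadraticDatum σ ϖ d t` there is a `σ`-fixed UNIT `c` such that every non-zero `σ`-fixed `x` is a norm `z·σz` or `c` times a norm — `[F^× : N_{K∕F}K^×] ≤ 2` for
`F = K^σ`, with a unit representative of the possibly non-trivial class (the `hNI` binder of ★ p855240 `stableLawAt_of_normIndexTwo_of_modelSum`, the `hdich` binder of ★ p855115 ∕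
★ p855032 §4).  (NI2) FILE DAG (first seat F0P3-p01 (g30), second seat LH4-p09 (g2)): ★ LEG 1 `WildQuadraticDatumNormGradedSteps` (Serre V §3 Prop. 5 (ii)–(iii): the graded
norm maps below ∕ at the break) ⟵ ★ LEG 2 `WildQuadraticDatumUnitNormIndexTwo` (the dichotomy on the FIXED UNITS: wild by descent + ★ p854729 deep norms, tame by ★ B-p10) ⟵ THIS
payer (the reduction from units to all fixed `x ≠ 0`, and the registered binders `[CompleteSpace K]`, `[Fintype 𝓀[K]]`).

THE MATHEMATICS of the last step (Serre XV §2: `K^× = ϖ^ℤ × U`, and a uniformiser of `F` is a norm).  A `σ`-fixed `x ≠ 0` has EVEN valuation `exp 2n` (datum clause 4); `π₀ = ϖσϖ`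
is `σ`-fixed (★ `map_varpi_mul_map`), of valuation `exp(−2)`, and a NORM: `π₀^{−n} = N(ϖ^{−n})`.  Hence `u = x·π₀^n` is a fixed unit, and `x = u·N(ϖ^{−n})` resp. `c·x = (c·u)·N(ϖ^{−n})`
inherits the unit dichotomy (norms multiply, ★ LEG 1 `mul_map_mul_map`).  Completeness enters only through ★ `isAdicComplete_valuedInteger_of_completeSpace` (`𝒪[K]` is
`𝓂`-adically complete), finiteness of `𝓀[K]` through the `Fintype ⇒ Finite` instance.

* §1 **`normIndexTwo_of_units`** (the reduction, no completeness).   §2 **`normIndexTwo`** (the head, registered type token for token).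

HONEST LABEL: HC_CM is proved only modulo the 7 printed citations (2 remaining named inputs: hLiu418 = stmt-HodgeConjecture-24832, h413 = stmt-HodgeConjecture-24833) until
rung 0 closes; this file pays one tier-1 stub of the sibling line (count-neutral until the line closes its organ).

## References
* [Serre1979] J.-P. Serre, *Local Fields*, GTM 67 (1979), Ch. V §3 Prop. 5, Cor. 2–3 (norms on the unit filtration of a totally ramified cyclic extension of prime degree),
  Ch. XV §2 (norm groups).
* [NeukirchANT1999] J. Neukirch, *Algebraic Number Theory* (1999), Ch. V (1.3) (local reciprocity: `[K^× : N_{L∕K}L^×] = [L : K]` for abelian `L∕K`).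
-/

set_option autoImplicit false

noncomputable section

open scoped Valued WithZero
open WithZero

namespace Summit.HodgeConjecture.HodgeConjecture.Cruxes.H413.F0P3cDyRamNormIndexTwo

open Literature.NumberTheory.Automorphic.UnitaryThreeFourFrame
open Literature.NumberTheory.LocalFields Literature.NumberTheory.LocalFields.WildQuadraticDatum

variable {K : Type} [Field K] [Valued K ℤᵐ⁰] {σ : K →+* K} {ϖ : K} {d t : ℕ}   -- `IsRamifiedQuadraticDatum` is stated over `K : Type`

/-! ## §1 The reduction of (NI2) to the `σ`-fixed UNITS -/

/-- **REDUCTION OF (NI2) TO FIXED UNITS** (no completeness): if a fixed `c` satisfies the norm dichotomy on the `σ`-fixed UNITS, it satisfies it on every non-zero `σ`-fixed `x` —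
`v x = exp 2n` (datum clause 4), `u = x·(ϖσϖ)^n` is a fixed unit, and `x = u·N(ϖ^{−n})` (norms multiply, ★ `mul_map_mul_map`). [cite: Serre1979, Ch. XV §2] [cite: NeukirchANT1999, Ch. V (1.3)] -/
theorem normIndexTwo_of_units (hD : IsRamifiedQuadraticDatum σ ϖ d t) {c : K}
    (hc : ∀ u : K, σ u = u → Valued.v u = 1 → (∃ z : K, z * σ z = u) ∨ ∃ z : K, z * σ z = c * u) :
    ∀ x : K, σ x = x → x ≠ 0 → (∃ z : K, z * σ z = x) ∨ ∃ z : K, z * σ z = c * x := by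
  obtain ⟨hσ, hvσ, hϖ, heven, -, -, -⟩ := hD
  intro x hσx hx0
  obtain ⟨n, hn⟩ := heven x hσx hx0
  have hϖ0 : ϖ ≠ 0 := fun h => by rw [h, map_zero] at hϖ; exact (exp_ne_zero hϖ.symm).elim
  set π₀ : K := ϖ * σ ϖ with hπ₀
  have hσπ₀ : σ π₀ = π₀ := map_varpi_mul_map hσ
  have hπ₀0 : π₀ ≠ 0 := mul_ne_zero hϖ0 ((map_ne_zero σ).2 hϖ0)
  have hvπ₀ : Valued.v π₀ = exp (-2 : ℤ) := by
    rw [hπ₀, map_mul, hvσ, hϖ, ← exp_add]; norm_num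
  -- the fixed unit `u = x · π₀ ^ n`
  set u : K := x * π₀ ^ n with hu
  have hσu : σ u = u := by rw [hu, map_mul, map_zpow₀, hσx, hσπ₀]
  have hvu : Valued.v u = 1 := by
    rw [hu, map_mul, map_zpow₀, hn, hvπ₀, ← exp_zsmul, ← exp_add, ← exp_zero]
    congr 1; simp only [smul_eq_mul]; ring
  -- `x = u · N(ϖ^{-n})`
  have hN : ϖ ^ (-n) * σ (ϖ ^ (-n)) = (π₀ ^ n)⁻¹ := by
    rw [map_zpow₀, ← mul_zpow, ← hπ₀, zpow_neg]
  have hx : x = u * (ϖ ^ (-n) * σ (ϖ ^ (-n))) := by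
    rw [hN, hu, mul_assoc, mul_inv_cancel₀ (zpow_ne_zero n hπ₀0), mul_one]
  rcases hc u hσu hvu with ⟨z, hz⟩ | ⟨z, hz⟩
  · refine Or.inl ⟨z * ϖ ^ (-n), ?_⟩
    rw [← mul_map_mul_map, hz, ← hx]
  · refine Or.inr ⟨z * ϖ ^ (-n), ?_⟩
    rw [← mul_map_mul_map, hz, hx, mul_assoc]

/-! ## §2 The head: (NI2) `stub_U3_normIndexTwo` -/

/-- **(NI2) LOCAL NORM INDEX TWO WITH A UNIT WITNESS — `U3_Laws.stub_U3_normIndexTwo` token for token**: for every ramified quadratic datum over a complete `K` with finite residue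
field there is a `σ`-fixed unit `c` such that every non-zero `σ`-fixed `x` is `z·σz` or `c·x = z·σz` (`[K^σ^× : N K^×] ≤ 2`).  The unit dichotomy is ★ LH4-p09's
`exists_unit_norm_dichotomy_of_isRamifiedQuadraticDatum` (Serre V §3: tame by the residue quadratic character, wild by descent along the unit filtration to the break and ★ p854729 below
it) on the `𝓂`-adically complete `𝒪[K]` (★ `isAdicComplete_valuedInteger_of_completeSpace`); §1 reduces to units. [cite: Serre1979, Ch. V §3 Prop. 5, Cor. 2–3; Ch. XV §2] [cite: NeukirchANT1999, Ch. V (1.3)] -/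
theorem normIndexTwo :
    ∀ {K : Type} [Field K] [Valued K ℤᵐ⁰] [CompleteSpace K] [Fintype 𝓀[K]] (σ : K →+* K) (ϖ : K) (d t : ℕ),
      IsRamifiedQuadraticDatum σ ϖ d t →
        ∃ c : K, σ c = c ∧ Valued.v c = 1 ∧ ∀ x : K, σ x = x → x ≠ 0 → (∃ z : K, z * σ z = x) ∨ ∃ z : K, z * σ z = c * x := by
  intro K _ _ _ _ σ ϖ d t hD
  haveI : IsAdicComplete 𝓂[K] 𝒪[K] := isAdicComplete_valuedInteger_of_completeSpace hD.2.2.1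
  obtain ⟨c, hσc, hvc, hc⟩ := exists_unit_norm_dichotomy_of_isRamifiedQuadraticDatum σ ϖ d t hD
  exact ⟨c, hσc, hvc, normIndexTwo_of_units hD hc⟩

end Summit.HodgeConjecture.HodgeConjecture.Cruxes.H413.F0P3cDyRamNormIndexTwo

end
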